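import Summits.CriticalPhenomena.SAWScalingLimit.Theorems.SAWLoopFugacityFlowAvoidanceLimitExcursionRatioSelf
import Literature.Probability.LatticeModels.CellDomainBoundary

/-!
# The two-sided first-exit / last-entrance decomposition of the killed-SRW Green's-function ratio
— stub `stub_greenRatioDecomposition` (S3a) of line `symplectic-fermion-anchor`
(crux `SAWLoopFugacityFlow.AvoidanceLimit`, stmt-CriticalPhenomena-10649)

Setting: `H = discreteDomainGraph Ω δ ≤ ℤ²`, the confined graph `H^c = confinedGraph Ω S δ ≤ H`,
the common volume `Λ = meshDomainFinset Ω δ`, `G_K = greenEntry K Λ` the killed simple-random-walk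
Green's function of `K ∈ {H, H^c}` (helper file `…ExcursionRatioGreen`), two centres `pa, pb` with
`dist pa pb ≥ 2r + 2δ`, the lattice balls `B_a = {x | dist (δx) pa < r}`, `B_b` likewise, and ball
agreement `S ∩ B(p, ε) = Ω ∩ B(p, ε)` at `p = pa, pb` with `r + 2δ ≤ ε`.

* `KilledGreen.transition_pow_apply_eq_zero_of_not_mem`, `greenEntry_eq_zero_of_not_mem` — for a
  graph `K'` all of whose edges end in `B`, the walk started in `B` never leaves `B`:
  `G_{K'}(a, u) = 0` for `a ∈ B`, `u ∉ B`;
* `greenEntry_eq_sum_exitKernel_mul` — the ONE-SIDED first-exit decomposition: with `K' = K|_B`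
  (the edges of `K` inside `B`) and `a ∈ B`, `y ∉ B`,
  `G_K(a, y) = Σ_v E_a(v) G_K(v, y)`, `E_a(v) = Σ_u G_{K'}(a, u) (P_K − P_{K'})_{uv}` (the resolvent
  identity `greenEntry_sub_greenEntry_eq_sum` of `…ExcursionRatioSelf` plus `G_{K'}(a, y) = 0`);
  the exit kernel `E_a` is nonnegative (`exitKernel_nonneg`), supported on the exit sphere
  `v ∉ B`, `v ∼_K u ∈ B` (`exitKernel_ne_zero`), and depends on `K` only through the edges of `K`
  at vertices `u` with `G_{K'}(a, u) ≠ 0` (`exitKernel_congr`);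
* `greenEntry_eq_sum_sum_exitKernel` — the TWO-SIDED decomposition
  `G_K(a, b) = Σ_{v, w} E_a(v) E_b(w) G_K(v, w)` (first exit from `B_a`, symmetry
  `greenEntry_comm`, first exit from `B_b` = last entrance into `B_b`);
* `div_sum_sum_mem_of_termwise` — a ratio of two such double sums with the SAME nonnegative kernels
  is squeezed between the termwise bounds;
* `confinedGraph_adj_iff_of_dist_lt` — inside `B(pa, r)` (one endpoint) the confined and the
  unconfined graph have the same edges (`confinedGraph_adj_iff_of_ball`, convexity of balls, one
  lattice step moves the mesh point by `≤ δ`), so `H` and `H^c` have the same restriction to `B_a`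
  and the SAME exit kernels;
* the registered closing theorem `stub_greenRatioDecomposition`: `greenRatio Ω S δ a b` is a convex
  combination of the interior ratios `G_{H^c}(v, w)/G_H(v, w)` over sphere pairs
  `r ≤ dist (δv) pa < r + δ`, `r ≤ dist (δw) pb < r + δ` with `G_H(v, w) > 0`, hence any bound
  `m ≤ · ≤ M` valid there transfers to `greenRatio Ω S δ a b`.

Sources: G. F. Lawler, *Intersections of Random Walks* (1991), §1.4–§1.5 (first-exit /
last-exit decompositions of the killed walk's Green's function) [Lawler1991]; folklore linear
algebra (resolvent identity). No definitions.
-/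

noncomputable section

open scoped BigOperators Topology Classical
open Filter Finset
open Literature.Probability.RandomPlanarGeometry Literature.Probability.LatticeModels

namespace Summit.CriticalPhenomena.SAWScalingLimit.Theorems.AvoidanceLimit.Anchor

namespace KilledGreen

/-- If every edge of `K'` ends in `B`, the killed walk of `K'` started in `B` stays in `B`:
`(Pⁿ)_{au} = 0` for `a ∈ B`, `u ∉ B`. [folklore] -/
theorem transition_pow_apply_eq_zero_of_not_mem {K' : SimpleGraph (Site 2)} {B : Set (Site 2)}
    (hB : ∀ x y, K'.Adj x y → y ∈ B) {Λ : Finset (Site 2)} {a u : Λ} (ha : (a : Site 2) ∈ B)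
    (hu : (u : Site 2) ∉ B) (n : ℕ) : (((4 : ℝ)⁻¹ • adjMat K' Λ) ^ n) a u = 0 := by
  cases n with
  | zero =>
      rw [pow_zero, Matrix.one_apply, if_neg]
      rintro rfl
      exact hu ha
  | succ n =>
      rw [pow_succ, Matrix.mul_apply]
      refine Finset.sum_eq_zero fun z _ => ?_
      rw [transition_apply, if_neg fun h => hu (hB _ _ h), mul_zero]

end KilledGreen

open KilledGreen

/-! ## One-sided first-exit decomposition and the exit kernel -/

/-- If every edge of `K' ≤ ℤ²` ends in `B`, then `greenEntry K' Λ a u = 0` for `a ∈ B`, `u ∉ B`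
(no walk of `K'` leaves `B`). [folklore] -/
theorem greenEntry_eq_zero_of_not_mem {K' : SimpleGraph (Site 2)} (hK' : K' ≤ zdGraph 2)
    {B : Set (Site 2)} (hB : ∀ x y, K'.Adj x y → y ∈ B) (Λ : Finset (Site 2)) {a u : Site 2}
    (ha : a ∈ B) (hu : u ∉ B) : greenEntry K' Λ a u = 0 := by
  by_cases h : a ∈ Λ ∧ u ∈ Λ
  · rw [greenEntry_eq_tsum hK' h.1 h.2]
    exact (tsum_congr fun n => transition_pow_apply_eq_zero_of_not_mem hB
      (a := ⟨a, h.1⟩) (u := ⟨u, h.2⟩) ha hu n).trans tsum_zero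
  · exact greenEntry_of_not K' h

/-- **One-sided first-exit decomposition.** For `K' ≤ K ≤ ℤ²` with every edge of `K'` ending in
`B`, `a ∈ B ∩ Λ` and `y ∈ Λ ∖ B`:
`G_K(a, y) = Σ_v (Σ_u G_{K'}(a, u) (P_K − P_{K'})_{uv}) · G_K(v, y)` — the resolvent identity
`greenEntry_sub_greenEntry_eq_sum` with `G_{K'}(a, y) = 0`. [cite: Lawler1991, §1.5] -/
theorem greenEntry_eq_sum_exitKernel_mul {K K' : SimpleGraph (Site 2)} (hK : K ≤ zdGraph 2)
    (hK' : K' ≤ K) {B : Set (Site 2)} (hB : ∀ x y, K'.Adj x y → y ∈ B) {Λ : Finset (Site 2)}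
    {a y : Site 2} (ha : a ∈ Λ) (hy : y ∈ Λ) (haB : a ∈ B) (hyB : y ∉ B) :
    greenEntry K Λ a y = ∑ v : Λ, (∑ u : Λ, greenEntry K' Λ a u *
      (((4 : ℝ)⁻¹ • adjMat K Λ - (4 : ℝ)⁻¹ • adjMat K' Λ) u v)) * greenEntry K Λ v y := by
  have h := greenEntry_sub_greenEntry_eq_sum hK hK' ha hy
  rwa [greenEntry_eq_zero_of_not_mem (hK'.trans hK) hB Λ haB hyB, sub_zero] at h

/-- The exit kernel `E_a(v) = Σ_u G_{K'}(a, u) (P_K − P_{K'})_{uv}` is nonnegative for `K' ≤ K ≤ ℤ²`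
(`G_{K'} ≥ 0` and `P_K − P_{K'} ≥ 0` entrywise). [folklore] -/
theorem exitKernel_nonneg {K K' : SimpleGraph (Site 2)} (hK : K ≤ zdGraph 2) (hK' : K' ≤ K)
    (Λ : Finset (Site 2)) (a : Site 2) (v : Λ) :
    0 ≤ ∑ u : Λ, greenEntry K' Λ a u *
      (((4 : ℝ)⁻¹ • adjMat K Λ - (4 : ℝ)⁻¹ • adjMat K' Λ) u v) := by
  refine Finset.sum_nonneg fun u _ => mul_nonneg (greenEntry_nonneg (hK'.trans hK) Λ a u) ?_
  rw [Matrix.sub_apply, transition_apply, transition_apply, sub_nonneg]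
  by_cases h : K'.Adj u.1 v.1
  · rw [if_pos h, if_pos (hK' h)]
  · rw [if_neg h]
    split_ifs <;> norm_num

/-- **Support of the exit kernel.** If `K'` is exactly the set of edges of `K ≤ ℤ²` inside `B` and
`a ∈ B`, then `E_a(v) ≠ 0` forces `v ∉ B` and `v ∼_K u` for some `u ∈ B ∩ Λ`: the kernel lives
on the edge boundary of `B`. [folklore] -/
theorem exitKernel_ne_zero {K K' : SimpleGraph (Site 2)} (hK : K ≤ zdGraph 2) {B : Set (Site 2)}
    (hK'B : ∀ x y, K'.Adj x y ↔ K.Adj x y ∧ x ∈ B ∧ y ∈ B) {Λ : Finset (Site 2)} {a : Site 2}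
    (haB : a ∈ B) {v : Λ} (hv : ∑ u : Λ, greenEntry K' Λ a u *
      (((4 : ℝ)⁻¹ • adjMat K Λ - (4 : ℝ)⁻¹ • adjMat K' Λ) u v) ≠ 0) :
    (v : Site 2) ∉ B ∧ ∃ u : Λ, (u : Site 2) ∈ B ∧ K.Adj u v := by
  have hK' : K' ≤ K := fun x y h => ((hK'B x y).1 h).1
  have hB : ∀ x y, K'.Adj x y → y ∈ B := fun x y h => ((hK'B x y).1 h).2.2
  obtain ⟨u, -, hu⟩ := Finset.exists_ne_zero_of_sum_ne_zero hv
  have hu1 : greenEntry K' Λ a u ≠ 0 := fun h => hu (by rw [h, zero_mul])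
  have hu2 : ((4 : ℝ)⁻¹ • adjMat K Λ - (4 : ℝ)⁻¹ • adjMat K' Λ) u v ≠ 0 := fun h =>
    hu (by rw [h, mul_zero])
  have huB : (u : Site 2) ∈ B := by
    by_contra h
    exact hu1 (greenEntry_eq_zero_of_not_mem (hK'.trans hK) hB Λ haB h)
  rw [Matrix.sub_apply, transition_apply, transition_apply] at hu2
  have hadj : K.Adj u v := by
    by_contra h
    rw [if_neg h, if_neg fun h' => h (hK' h'), sub_zero] at hu2
    exact hu2 rfl
  refine ⟨fun hvB => ?_, u, huB, hadj⟩
  rw [if_pos hadj, if_pos ((hK'B _ _).2 ⟨hadj, huB, hvB⟩), sub_self] at hu2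
  exact hu2 rfl

/-- **The exit kernel only sees the edges of `K` at the vertices charged by `G_{K'}(a, ·)`**: two
graphs `K₁, K₂` with the same edges at every `u` with `G_{K'}(a, u) ≠ 0` have the same exit kernel
out of `K'`. [folklore] -/
theorem exitKernel_congr {K₁ K₂ K' : SimpleGraph (Site 2)} {Λ : Finset (Site 2)} {a : Site 2}
    (h : ∀ u v : Λ, greenEntry K' Λ a u ≠ 0 → (K₁.Adj u v ↔ K₂.Adj u v)) (v : Λ) :
    ∑ u : Λ, greenEntry K' Λ a u * (((4 : ℝ)⁻¹ • adjMat K₁ Λ - (4 : ℝ)⁻¹ • adjMat K' Λ) u v) =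
      ∑ u : Λ, greenEntry K' Λ a u *
        (((4 : ℝ)⁻¹ • adjMat K₂ Λ - (4 : ℝ)⁻¹ • adjMat K' Λ) u v) := by
  refine Finset.sum_congr rfl fun u _ => ?_
  by_cases hu : greenEntry K' Λ a u = 0
  · rw [hu, zero_mul, zero_mul]
  · rw [Matrix.sub_apply, Matrix.sub_apply, transition_apply, transition_apply, transition_apply,
      if_congr (h u v hu) rfl rfl]

/-! ## The two-sided decomposition and the transfer of termwise bounds -/

/-- **Two-sided first-exit / last-entrance decomposition.** For `Ka, Kb ≤ K ≤ ℤ²` with the edges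
of `Ka` ending in `Ba` and those of `Kb` in `Bb`, `a ∈ Ba`, `b ∈ Bb ∖ Ba`, and functions `Ea, Eb`
equal to the exit kernels of `K` out of `Ka` (from `a`) and out of `Kb` (from `b`), with `Ea`
supported off `Bb`: `G_K(a, b) = Σ_{v, w} Ea(v) Eb(w) G_K(v, w)` — first exit from `Ba`, then
(by the symmetry `greenEntry_comm`) first exit from `Bb` of the reversed walk, i.e. last entrance
into `Bb`. [cite: Lawler1991, §1.5] -/
theorem greenEntry_eq_sum_sum_exitKernel {K Ka Kb : SimpleGraph (Site 2)} (hK : K ≤ zdGraph 2)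
    (hKa : Ka ≤ K) (hKb : Kb ≤ K) {Ba Bb : Set (Site 2)} (hBa : ∀ x y, Ka.Adj x y → y ∈ Ba)
    (hBb : ∀ x y, Kb.Adj x y → y ∈ Bb) {Λ : Finset (Site 2)} {a b : Site 2} (ha : a ∈ Λ)
    (hb : b ∈ Λ) (haB : a ∈ Ba) (hbB : b ∈ Bb) (hba : b ∉ Ba) (Ea Eb : Λ → ℝ)
    (hEa : ∀ v : Λ, ∑ u : Λ, greenEntry Ka Λ a u *
      (((4 : ℝ)⁻¹ • adjMat K Λ - (4 : ℝ)⁻¹ • adjMat Ka Λ) u v) = Ea v)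
    (hEb : ∀ w : Λ, ∑ u : Λ, greenEntry Kb Λ b u *
      (((4 : ℝ)⁻¹ • adjMat K Λ - (4 : ℝ)⁻¹ • adjMat Kb Λ) u w) = Eb w)
    (hsupp : ∀ v : Λ, Ea v ≠ 0 → (v : Site 2) ∉ Bb) :
    greenEntry K Λ a b = ∑ v : Λ, ∑ w : Λ, Ea v * Eb w * greenEntry K Λ v w := by
  rw [greenEntry_eq_sum_exitKernel_mul hK hKa hBa ha hb haB hba]
  refine Finset.sum_congr rfl fun v _ => ?_
  rw [hEa v]
  by_cases hv : Ea v = 0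
  · simp only [hv, zero_mul, Finset.sum_const_zero]
  · rw [greenEntry_comm hK Λ v b, greenEntry_eq_sum_exitKernel_mul hK hKb hBb hb v.2 hbB (hsupp v hv),
      Finset.mul_sum]
    refine Finset.sum_congr rfl fun w _ => ?_
    rw [hEb w, greenEntry_comm hK Λ w v, mul_assoc]

/-- **Termwise bounds transfer to the ratio of two double sums with the same nonnegative kernels.**
If `0 ≤ Gc ≤ G` entrywise, `Ea, Eb ≥ 0`, the `G`-sum is positive, and `m ≤ Gc/G ≤ M` at every pair
charged by both kernels where `G > 0`, then `m ≤ (Σ Ea Eb Gc)/(Σ Ea Eb G) ≤ M`. [folklore] -/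
theorem div_sum_sum_mem_of_termwise {Λ : Finset (Site 2)} (Ea Eb : Λ → ℝ) (G Gc : Λ → Λ → ℝ)
    (m M : ℝ) (hEa : ∀ v, 0 ≤ Ea v) (hEb : ∀ w, 0 ≤ Eb w) (hGc : ∀ v w, 0 ≤ Gc v w)
    (hle : ∀ v w, Gc v w ≤ G v w) (hpos : 0 < ∑ v, ∑ w, Ea v * Eb w * G v w)
    (hmM : ∀ v w, Ea v ≠ 0 → Eb w ≠ 0 → 0 < G v w → m ≤ Gc v w / G v w ∧ Gc v w / G v w ≤ M) :
    m ≤ (∑ v, ∑ w, Ea v * Eb w * Gc v w) / (∑ v, ∑ w, Ea v * Eb w * G v w) ∧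
      (∑ v, ∑ w, Ea v * Eb w * Gc v w) / (∑ v, ∑ w, Ea v * Eb w * G v w) ≤ M := by
  have key : ∀ v w, m * (Ea v * Eb w * G v w) ≤ Ea v * Eb w * Gc v w ∧
      Ea v * Eb w * Gc v w ≤ M * (Ea v * Eb w * G v w) := by
    intro v w
    by_cases hv : Ea v = 0
    · simp [hv]
    by_cases hw : Eb w = 0
    · simp [hw]
    rcases ((hGc v w).trans (hle v w)).eq_or_lt with hG | hG
    · have hG' : G v w = 0 := hG.symm
      have hGc0 : Gc v w = 0 := le_antisymm ((hle v w).trans_eq hG') (hGc v w)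
      simp [hG', hGc0]
    · obtain ⟨h1, h2⟩ := hmM v w hv hw hG
      rw [le_div_iff₀ hG] at h1
      rw [div_le_iff₀ hG] at h2
      have hE : 0 ≤ Ea v * Eb w := mul_nonneg (hEa v) (hEb w)
      constructor
      · calc m * (Ea v * Eb w * G v w) = Ea v * Eb w * (m * G v w) := by ring
          _ ≤ Ea v * Eb w * Gc v w := mul_le_mul_of_nonneg_left h1 hE
      · calc Ea v * Eb w * Gc v w ≤ Ea v * Eb w * (M * G v w) := mul_le_mul_of_nonneg_left h2 hE
          _ = M * (Ea v * Eb w * G v w) := by ring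
  constructor
  · rw [le_div_iff₀ hpos, Finset.mul_sum]
    refine Finset.sum_le_sum fun v _ => ?_
    rw [Finset.mul_sum]
    exact Finset.sum_le_sum fun w _ => (key v w).1
  · rw [div_le_iff₀ hpos, Finset.mul_sum]
    refine Finset.sum_le_sum fun v _ => ?_
    rw [Finset.mul_sum]
    exact Finset.sum_le_sum fun w _ => (key v w).2

/-! ## Lattice geometry: one step moves the mesh point by `≤ δ`; local agreement of `H^c` and `H` -/

/-- A lattice neighbour `v` of a site `u` whose mesh point is within `r` of `p` has its mesh point
within `r + δ` of `p` (`δ ≥ 0`): nearest neighbours of `ℤ²` have mesh points at distance `≤ δ`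
(the displacement is `±δ` or `±δi`, `abs_re_im_meshPoint_sub_of_adj`). [folklore] -/
theorem dist_meshPoint_lt_add_of_adj {δ : ℝ} (hδ : 0 ≤ δ) {p : ℂ} {r : ℝ} {u v : Site 2}
    (hu : dist (meshPoint δ u) p < r) (h : (zdGraph 2).Adj u v) :
    dist (meshPoint δ v) p < r + δ := by
  obtain ⟨-, -, hsum⟩ := abs_re_im_meshPoint_sub_of_adj hδ h
  have h2 : dist (meshPoint δ v) (meshPoint δ u) ≤ δ := by
    rw [Complex.dist_eq]
    exact (Complex.norm_le_abs_re_add_abs_im _).trans_eq hsum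
  have h1 := dist_triangle (meshPoint δ v) (meshPoint δ u) p
  linarith

/-- **Local agreement of the confined and the unconfined graph.** Under ball agreement
`S ∩ B(p, ε) = Ω ∩ B(p, ε)` with `r + 2δ ≤ ε`, `δ > 0`, an edge of `Ω_δ` with one endpoint within
`r` of `p` is an edge of `confinedGraph Ω S δ` (both endpoints lie in the convex ball `B(p, ε)`,
hence so does the segment; `confinedGraph_adj_iff_of_ball`). [folklore] -/
theorem confinedGraph_adj_iff_of_dist_lt {Ω S : Set ℂ} {p : ℂ} {ε r δ : ℝ} (hδ : 0 < δ)
    (hε : r + 2 * δ ≤ ε) (hball : S ∩ Metric.ball p ε = Ω ∩ Metric.ball p ε) {u v : Site 2}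
    (hu : dist (meshPoint δ u) p < r) :
    (confinedGraph Ω S δ).Adj u v ↔ (discreteDomainGraph Ω δ).Adj u v := by
  refine ⟨fun h => confinedGraph_le Ω S δ h, fun h => ?_⟩
  have hv : dist (meshPoint δ v) p < r + δ := dist_meshPoint_lt_add_of_adj hδ.le hu
    ((discreteDomainGraph_le_meshGraph Ω δ).trans (meshGraph_le_zdGraph Ω δ) h)
  have hu' : meshPoint δ u ∈ Metric.ball p ε := Metric.mem_ball.2 (by linarith)
  have hv' : meshPoint δ v ∈ Metric.ball p ε := Metric.mem_ball.2 (by linarith)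
  exact (confinedGraph_adj_iff_of_ball hball ((convex_ball p ε).segment_subset hu' hv')).2 h

/-- The restriction `K|_B` of a graph on `Site 2` to the edges inside `B` exists as a simple graph.
[folklore] -/
theorem exists_restrict_adj_iff (K : SimpleGraph (Site 2)) (B : Set (Site 2)) :
    ∃ K' : SimpleGraph (Site 2), ∀ x y, K'.Adj x y ↔ K.Adj x y ∧ x ∈ B ∧ y ∈ B :=
  ⟨{ Adj := fun x y => K.Adj x y ∧ x ∈ B ∧ y ∈ B
     symm := ⟨fun _ _ h => ⟨h.1.symm, h.2.2, h.2.1⟩⟩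
     loopless := ⟨fun _ h => K.irrefl h.1⟩ }, fun _ _ => Iff.rfl⟩

/-! ## The registered closing theorem -/

/-- **STUB S3a · `GreenRatioDecomposition` (two-sided first-exit / last-entrance decomposition).**
With `H = Ω_δ`, `H^c` the confined graph, `Λ = meshDomainFinset Ω δ`, the lattice balls
`B_a = {dist (δ·) pa < r}`, `B_b` likewise (`dist pa pb ≥ 2r + 2δ`), every walk `a → b` splits
at its first exit from `B_a` and its last entrance into `B_b`:
`G_K(a, b) = Σ_{v, w} E_a(v) E_b(w) G_K(v, w)` for BOTH `K = H` and `K = H^c` with the SAME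
nonnegative exit kernels (inside `B(pa, r + δ) ⊆ B(pa, ε)` and `B(pb, r + δ)` the two graphs have
the same edges by ball agreement), supported on the exit spheres `r ≤ dist (δv) pa < r + δ`,
`r ≤ dist (δw) pb < r + δ`. Hence `greenRatio Ω S δ a b = G_{H^c}(a, b)/G_H(a, b)` is a convex
combination of the interior ratios `G_{H^c}(v, w)/G_H(v, w)` over sphere pairs with
`G_H(v, w) > 0` (where `G_H(v, w) = 0` also `G_{H^c}(v, w) = 0`), and any bound `m ≤ · ≤ M` valid
there transfers. [cite: Lawler1991, §1.5] -/
theorem stub_greenRatioDecomposition :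
    ∀ (Ω S : Set ℂ) (pa pb : ℂ) (ε r δ : ℝ) (a b : Site 2) (m M : ℝ),
      Bornology.IsBounded Ω → 0 < δ → 0 < r → r + 2 * δ ≤ ε →
      S ∩ Metric.ball pa ε = Ω ∩ Metric.ball pa ε → S ∩ Metric.ball pb ε = Ω ∩ Metric.ball pb ε →
      2 * r + 2 * δ ≤ dist pa pb →
      dist (meshPoint δ a) pa < r → dist (meshPoint δ b) pb < r →
      0 < greenEntry (discreteDomainGraph Ω δ) (meshDomainFinset Ω δ) a b →
      (∀ z y : Site 2, r ≤ dist (meshPoint δ z) pa → dist (meshPoint δ z) pa < r + δ →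
        r ≤ dist (meshPoint δ y) pb → dist (meshPoint δ y) pb < r + δ →
        0 < greenEntry (discreteDomainGraph Ω δ) (meshDomainFinset Ω δ) z y →
        m ≤ greenEntry (confinedGraph Ω S δ) (meshDomainFinset Ω δ) z y /
            greenEntry (discreteDomainGraph Ω δ) (meshDomainFinset Ω δ) z y ∧
          greenEntry (confinedGraph Ω S δ) (meshDomainFinset Ω δ) z y /
            greenEntry (discreteDomainGraph Ω δ) (meshDomainFinset Ω δ) z y ≤ M) →
      m ≤ greenRatio Ω S δ a b ∧ greenRatio Ω S δ a b ≤ M := by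
  intro Ω S pa pb ε r δ a b m M _hΩ hδ _hr hε hpa hpb hab ha hb hpos hmM
  unfold greenRatio
  set H := discreteDomainGraph Ω δ with hH_def
  set Hc := confinedGraph Ω S δ with hHc_def
  set Λ := meshDomainFinset Ω δ with hΛ_def
  have hH : H ≤ zdGraph 2 := (discreteDomainGraph_le_meshGraph Ω δ).trans (meshGraph_le_zdGraph Ω δ)
  have hHc : Hc ≤ H := confinedGraph_le Ω S δ
  -- the legs lie in the volume
  have hmem : a ∈ Λ ∧ b ∈ Λ := by
    by_contra h
    exact hpos.ne' (greenEntry_of_not H h)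
  -- the two lattice balls and the restricted graphs `H|_{B_a}`, `H|_{B_b}`
  set Ba : Set (Site 2) := {x | dist (meshPoint δ x) pa < r} with hBa_def
  set Bb : Set (Site 2) := {x | dist (meshPoint δ x) pb < r} with hBb_def
  have haB : a ∈ Ba := ha
  have hbB : b ∈ Bb := hb
  obtain ⟨Ka, hKa⟩ := exists_restrict_adj_iff H Ba
  obtain ⟨Kb, hKb⟩ := exists_restrict_adj_iff H Bb
  have hKaH : Ka ≤ H := fun x y h => ((hKa x y).1 h).1
  have hKbH : Kb ≤ H := fun x y h => ((hKb x y).1 h).1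
  have hBa : ∀ x y, Ka.Adj x y → y ∈ Ba := fun x y h => ((hKa x y).1 h).2.2
  have hBb : ∀ x y, Kb.Adj x y → y ∈ Bb := fun x y h => ((hKb x y).1 h).2.2
  -- local agreement of `H^c` and `H` near `pa`, `pb`
  have hagree_a : ∀ u v : Site 2, u ∈ Ba → (Hc.Adj u v ↔ H.Adj u v) := fun u v hu =>
    confinedGraph_adj_iff_of_dist_lt hδ hε hpa hu
  have hagree_b : ∀ u v : Site 2, u ∈ Bb → (Hc.Adj u v ↔ H.Adj u v) := fun u v hu =>
    confinedGraph_adj_iff_of_dist_lt hδ hε hpb hu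
  have hKaHc : Ka ≤ Hc := fun x y h => by
    obtain ⟨hxy, hx, -⟩ := (hKa x y).1 h
    exact (hagree_a x y hx).2 hxy
  have hKbHc : Kb ≤ Hc := fun x y h => by
    obtain ⟨hxy, hx, -⟩ := (hKb x y).1 h
    exact (hagree_b x y hx).2 hxy
  -- `b ∉ B_a` (the balls are `2r + 2δ` apart)
  have hba : b ∉ Ba := by
    intro (h : dist (meshPoint δ b) pa < r)
    have h3 := dist_triangle pa (meshPoint δ b) pb
    rw [dist_comm pa (meshPoint δ b)] at h3
    linarith
  -- the exit kernels of `H` out of the two balls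
  set Ea : Λ → ℝ := fun v => ∑ u : Λ, greenEntry Ka Λ a u *
    (((4 : ℝ)⁻¹ • adjMat H Λ - (4 : ℝ)⁻¹ • adjMat Ka Λ) u v) with hEa_def
  set Eb : Λ → ℝ := fun w => ∑ u : Λ, greenEntry Kb Λ b u *
    (((4 : ℝ)⁻¹ • adjMat H Λ - (4 : ℝ)⁻¹ • adjMat Kb Λ) u w) with hEb_def
  -- their supports: the two exit spheres
  have hEa_sph : ∀ v : Λ, Ea v ≠ 0 →
      r ≤ dist (meshPoint δ v) pa ∧ dist (meshPoint δ v) pa < r + δ := by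
    intro v hv
    obtain ⟨hvB, u, huB, hadj⟩ := exitKernel_ne_zero hH hKa haB hv
    exact ⟨not_lt.1 hvB, dist_meshPoint_lt_add_of_adj hδ.le huB (hH hadj)⟩
  have hEb_sph : ∀ w : Λ, Eb w ≠ 0 →
      r ≤ dist (meshPoint δ w) pb ∧ dist (meshPoint δ w) pb < r + δ := by
    intro w hw
    obtain ⟨hwB, u, huB, hadj⟩ := exitKernel_ne_zero hH hKb hbB hw
    exact ⟨not_lt.1 hwB, dist_meshPoint_lt_add_of_adj hδ.le huB (hH hadj)⟩
  have hEa_not : ∀ v : Λ, Ea v ≠ 0 → (v : Site 2) ∉ Bb := by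
    intro v hv (h : dist (meshPoint δ v) pb < r)
    have h1 := (hEa_sph v hv).2
    have h3 := dist_triangle pa (meshPoint δ v) pb
    rw [dist_comm pa (meshPoint δ (v : Site 2))] at h3
    linarith
  -- the kernels of `H^c` coincide with those of `H`
  have hKa_zd : Ka ≤ zdGraph 2 := hKaH.trans hH
  have hKb_zd : Kb ≤ zdGraph 2 := hKbH.trans hH
  have hEa_c : ∀ v : Λ, ∑ u : Λ, greenEntry Ka Λ a u *
      (((4 : ℝ)⁻¹ • adjMat Hc Λ - (4 : ℝ)⁻¹ • adjMat Ka Λ) u v) = Ea v := by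
    intro v
    refine exitKernel_congr (fun u v' hu => hagree_a u v' ?_) v
    by_contra h
    exact hu (greenEntry_eq_zero_of_not_mem hKa_zd hBa Λ haB h)
  have hEb_c : ∀ w : Λ, ∑ u : Λ, greenEntry Kb Λ b u *
      (((4 : ℝ)⁻¹ • adjMat Hc Λ - (4 : ℝ)⁻¹ • adjMat Kb Λ) u w) = Eb w := by
    intro w
    refine exitKernel_congr (fun u w' hu => hagree_b u w' ?_) w
    by_contra h
    exact hu (greenEntry_eq_zero_of_not_mem hKb_zd hBb Λ hbB h)
  -- the two-sided decompositions of `G_H(a, b)` and `G_{H^c}(a, b)`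
  have hG : greenEntry H Λ a b = ∑ v : Λ, ∑ w : Λ, Ea v * Eb w * greenEntry H Λ v w :=
    greenEntry_eq_sum_sum_exitKernel hH hKaH hKbH hBa hBb hmem.1 hmem.2 haB hbB hba Ea Eb
      (fun _ => rfl) (fun _ => rfl) hEa_not
  have hGc : greenEntry Hc Λ a b = ∑ v : Λ, ∑ w : Λ, Ea v * Eb w * greenEntry Hc Λ v w :=
    greenEntry_eq_sum_sum_exitKernel (hHc.trans hH) hKaHc hKbHc hBa hBb hmem.1 hmem.2 haB hbB hba
      Ea Eb hEa_c hEb_c hEa_not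
  -- transfer the termwise bounds
  rw [hG, hGc]
  refine div_sum_sum_mem_of_termwise Ea Eb (fun v w => greenEntry H Λ v w)
    (fun v w => greenEntry Hc Λ v w) m M (fun v => exitKernel_nonneg hH hKaH Λ a v)
    (fun w => exitKernel_nonneg hH hKbH Λ b w)
    (fun v w => greenEntry_nonneg (hHc.trans hH) Λ v w)
    (fun v w => greenEntry_confined_le Ω S δ Λ v w) (by rwa [hG] at hpos) ?_
  intro v w hv hw hGvw
  obtain ⟨h1, h2⟩ := hEa_sph v hv
  obtain ⟨h3, h4⟩ := hEb_sph w hw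
  exact hmM v w h1 h2 h3 h4 hGvw

end Summit.CriticalPhenomena.SAWScalingLimit.Theorems.AvoidanceLimit.Anchor

end
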